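import Summits.Parity.GeneralizedHardyLittlewood.Theorems.RangeQualityExchangeRate

/-!
# Range–quality exchange (4/5): necessity — the summit conjunct implies every cell of the dial

Part of the decomp-parity lens-5 g10 certificate «RangeQualityExchange» (NODE HOME/STATUS.md l.484, critic CLEARED l.490 =
CRITIC-LEDGER row 89, writer DECISION L7 l.491: zero credit, helper beneath the existing leaf UU 26853), landed from the lens hand
`HOME/decomp-parity-lens-5/g10/hand/RangeQualityExchange.lean` (sha16 fc7ece3ca225b2c0, 1301 lines, rc 0 · 0 sorry · standard axioms)
VERBATIM by section in five files for the 400-line Theorems lint by the cell's prover-class seat census-1 g10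
(`RangeQualityExchangeCore` → `RangeQualityExchangeCoreLower` → `RangeQualityExchangeRate` → `RangeQualityExchangeNecessity` →
`RangeQualityExchange`; vocabulary `Theorems/RangeQualityExchangeDefs.lean`, p772649).  The hand's `private` shift-pair dictionary
copies (of `Theorems/PairsToGHL/Negative/{ShiftPairDictionary,UnboundedSiegelZeros}.lean`, which do not build on the current farm
snapshot, remote:stale:unbuilt 2026-08-30) stay `private` and sit in the part(s) that use them.

This file: the Green–Tao shift-pair dictionary (private copies) and `uniformUpperUpTo_of_ghl` / `uniformLowerUpTo_of_ghl` for every range `R`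
(hypothesis-free), with their block forms.  [cite: GreenTao2010, Example 1]
-/

open Finset Filter MeasureTheory
open scoped Topology ArithmeticFunction.vonMangoldt
open Literature.NumberTheory.Sieve Literature.Barriers.Parity
open Summit.Parity.GeneralizedHardyLittlewood.Theses

noncomputable section

namespace Summit.Parity.GeneralizedHardyLittlewood.RangeQualityExchange

/-! ## Private helper copies (see the module docstring; names and signatures identical to the unbuilt tree lemmas) -/

namespace Dictionary

/-! ### The shift pair `(n, n + h)` in the Green–Tao dictionary -/

/-- `ψ₁(n) = n`. [cite: GreenTao2010, Example 1] -/
private theorem shiftPairSystem_eval_zero (h : ℤ) (n : Fin 1 → ℤ) : (shiftPairSystem h 0).eval n = n 0 := by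
  simp [shiftPairSystem, AffLinForm.eval]

/-- `ψ₂(n) = n + h`. [cite: GreenTao2010, Example 1] -/
private theorem shiftPairSystem_eval_one (h : ℤ) (n : Fin 1 → ℤ) :
    (shiftPairSystem h 1).eval n = n 0 + h := by
  simp [shiftPairSystem, AffLinForm.eval]

/-- `ψ₁(x) = x` on `ℝ`. [cite: GreenTao2010, Example 1] -/
private theorem shiftPairSystem_realEval_zero (h : ℤ) (x : Fin 1 → ℝ) :
    (shiftPairSystem h 0).realEval x = x 0 := by
  simp [shiftPairSystem, AffLinForm.realEval]

/-- `ψ₂(x) = x + h` on `ℝ`. [cite: GreenTao2010, Example 1] -/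
private theorem shiftPairSystem_realEval_one (h : ℤ) (x : Fin 1 → ℝ) :
    (shiftPairSystem h 1).realEval x = x 0 + h := by
  simp [shiftPairSystem, AffLinForm.realEval]

/-- The shift pair `(n, n + h)` satisfies Green–Tao's standing hypotheses EXACTLY when `h ≠ 0`
(for `h = 0` the two forms coincide, `(a, b) = (1, 1)`). [cite: GreenTao2010, Def. 1.1] -/
private theorem isNondegenerateSystem_shiftPairSystem_iff {h : ℤ} :
    IsNondegenerateSystem (shiftPairSystem h) ↔ h ≠ 0 := by
  constructor
  · rintro ⟨-, hind⟩ rfl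
    have := hind 0 1 (by decide) 1 1 (fun n => by simp [shiftPairSystem, AffLinForm.eval])
    omega
  · intro hh
    refine ⟨fun i => ?_, fun i j hij a b hab => ?_⟩
    · fin_cases i <;> simp [shiftPairSystem]
    · have h0 := hab 0
      have h1 := hab 1
      fin_cases i <;> fin_cases j <;> simp_all [shiftPairSystem, AffLinForm.eval]

/-- `‖(n, n + h)‖_N = 1 + 1 + 0 + h/N ≤ 3` for `0 ≤ h ≤ N`. [cite: GreenTao2010, (1.1)] -/
private theorem affLinSize_shiftPairSystem_le {h N : ℕ} (hN : 0 < N) (hhN : h ≤ N) :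
    affLinSize (shiftPairSystem (h : ℤ)) (N : ℝ) ≤ 3 := by
  have hN0 : (0 : ℝ) < N := by exact_mod_cast hN
  unfold affLinSize
  simp only [Fin.sum_univ_two, Fin.sum_univ_one, shiftPairSystem, Matrix.cons_val_zero,
    Matrix.cons_val_one, Int.cast_one, abs_one, Int.cast_zero, zero_div, abs_zero, zero_add,
    Int.cast_natCast]
  have h2 : |(h : ℝ) / N| ≤ 1 := by
    rw [abs_of_nonneg (by positivity), div_le_one hN0]; exact_mod_cast hhN
  linarith

/-- Over the full box `K = [-N, N]` the von Mangoldt sum (1.2) of `(n, n + h)` is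
`∑_{n=1}^{N} Λ(n)Λ(n+h)` (terms with `n ≤ 0` vanish). [cite: GreenTao2010, (1.2)] -/
private theorem vonMangoldtSum_shiftPairSystem (h N : ℕ) :
    vonMangoldtSum (shiftPairSystem (h : ℤ)) (realBox 1 N) N = ∑ n ∈ Icc 1 N, Λ n * Λ (n + h) := by
  classical
  unfold vonMangoldtSum
  rw [Finset.filter_true_of_mem]
  swap
  · intro n hn
    have hn' := Fintype.mem_piFinset.mp hn
    simp only [realBox, Set.mem_Icc]
    refine ⟨fun j => ?_, fun j => ?_⟩
    · have := (Finset.mem_Icc.mp (hn' j)).1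
      simp only [realPoint]; exact_mod_cast this
    · have := (Finset.mem_Icc.mp (hn' j)).2
      simp only [realPoint]; exact_mod_cast this
  unfold latticeBox
  rw [sum_piFinset_const_fin_one]
  simp only [Fin.prod_univ_two, shiftPairSystem_eval_zero, shiftPairSystem_eval_one,
    intVonMangoldt]
  have hsub : Icc (1 : ℤ) N ⊆ Icc (-(N : ℤ)) N := Icc_subset_Icc (by omega) le_rfl
  rw [← Finset.sum_subset hsub]
  swap
  · intro m hm hm'
    simp only [Finset.mem_Icc, not_and, not_le] at hm hm'
    have hm0 : m ≤ 0 := by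
      by_contra h'
      exact absurd (hm' (by omega)) (by omega)
    rw [Int.toNat_eq_zero.mpr hm0, ArithmeticFunction.map_zero, zero_mul]
  refine Finset.sum_nbij' (fun m => m.toNat) (fun n => (n : ℤ)) (fun m hm => ?_) (fun n hn => ?_)
    (fun m hm => ?_) (fun n _ => by simp) (fun m hm => ?_)
  · simp only [Finset.mem_Icc] at hm ⊢; omega
  · simp only [Finset.mem_Icc] at hn ⊢; omega
  · simp only [Finset.mem_Icc] at hm; omega
  · simp only [Finset.mem_Icc] at hm
    rw [show (m + (h : ℤ)).toNat = m.toNat + h by omega]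

/-- `β_∞ = vol([-N, N] ∩ {x > 0} ∩ {x + h > 0}) = vol((0, N]) = N` for `(n, n + h)`, `h ≥ 0`.
[cite: GreenTao2010, (1.4)] -/
private theorem archFactor_shiftPairSystem (h N : ℕ) :
    archFactor (shiftPairSystem (h : ℤ)) (realBox 1 N) = N := by
  unfold archFactor
  have hset : realBox 1 (N : ℝ) ∩ {x | ∀ i, 0 < (shiftPairSystem (h : ℤ) i).realEval x} =
      Set.pi Set.univ (fun _ : Fin 1 => Set.Ioc (0 : ℝ) N) := by
    ext x
    simp only [realBox, Set.mem_inter_iff, Set.mem_Icc, Set.mem_setOf_eq, Set.mem_pi,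
      Set.mem_univ, true_implies, Set.mem_Ioc, Fin.forall_fin_two, Fin.forall_fin_one,
      Pi.le_def, shiftPairSystem_realEval_zero, shiftPairSystem_realEval_one]
    have hh0 : (0 : ℝ) ≤ ((h : ℤ) : ℝ) := by exact_mod_cast (Int.natCast_nonneg h)
    constructor
    · rintro ⟨⟨-, h2⟩, h3, -⟩
      exact ⟨h3, h2⟩
    · rintro ⟨h1, h2⟩
      have hN : (0 : ℝ) ≤ N := Nat.cast_nonneg N
      exact ⟨⟨by linarith, h2⟩, h1, by linarith⟩
  rw [hset, Real.volume_pi_Ioc_toReal]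
  · simp
  · intro i
    exact Nat.cast_nonneg N

/-! ### Local factors of `(n, n + h)` and the singular product -/

/-- `#{v mod p : v ≢ 0, v + h ≢ 0} = p - #{0, -h}`. [cite: GreenTao2010, Example 1] -/
private theorem goodCount_shiftPairSystem (h : ℤ) (p : ℕ) [Fact p.Prime] :
    goodCount (shiftPairSystem h) p = p - #({0, -(h : ZMod p)} : Finset (ZMod p)) := by
  classical
  have hz : ∀ v : Fin 1 → ZMod p, (shiftPairSystem h 0).modEval p v = v 0 := fun v => by
    simp [shiftPairSystem, AffLinForm.modEval]
  have ho : ∀ v : Fin 1 → ZMod p, (shiftPairSystem h 1).modEval p v = v 0 + (h : ZMod p) := fun v => by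
    simp [shiftPairSystem, AffLinForm.modEval]
  unfold goodCount
  have hcard : #{v : Fin 1 → ZMod p | ∀ i, ¬ (shiftPairSystem h i).modEval p v = 0} =
      #{w : ZMod p | w ∉ ({0, -(h : ZMod p)} : Finset (ZMod p))} := by
    refine Finset.card_nbij' (fun v => v 0) (fun w _ => w) (fun v hv => ?_) (fun w hw => ?_)
      (fun v _ => ?_) (fun w _ => rfl)
    · simp only [Finset.coe_filter, Finset.mem_univ, true_and, Set.mem_setOf_eq,
        Fin.forall_fin_two, hz, ho] at hv
      simp only [Finset.coe_filter, Finset.mem_univ, true_and, Set.mem_setOf_eq,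
        Finset.mem_insert, Finset.mem_singleton, not_or]
      exact ⟨hv.1, fun h' => hv.2 (by rw [h']; ring)⟩
    · simp only [Finset.coe_filter, Finset.mem_univ, true_and, Set.mem_setOf_eq,
        Finset.mem_insert, Finset.mem_singleton, not_or] at hw
      simp only [Finset.coe_filter, Finset.mem_univ, true_and, Set.mem_setOf_eq,
        Fin.forall_fin_two, hz, ho]
      exact ⟨hw.1, fun h' => hw.2 (by linear_combination h')⟩
    · funext i; simp [Fin.fin_one_eq_zero i]
  rw [hcard, Finset.filter_not, Finset.filter_mem_eq_inter, Finset.univ_inter,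
    Finset.card_univ_sdiff, ZMod.card]

/-- For a prime `p ∣ h`: `β_p = p⁻¹ (p/(p-1))² (p - 1) = p/(p-1)` (in particular `β₂ = 2` for even
`h`). [cite: GreenTao2010, Example 1] -/
private theorem localFactor_shiftPairSystem_of_dvd {h p : ℕ} (hp : p.Prime) (hdvd : p ∣ h) :
    localFactor (shiftPairSystem (h : ℤ)) p = (p : ℝ) / ((p : ℝ) - 1) := by
  haveI := Fact.mk hp
  have hzero : ((h : ℤ) : ZMod p) = 0 := by
    rw [Int.cast_natCast, ZMod.natCast_eq_zero_iff]; exact hdvd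
  rw [localFactor_prime, goodCount_shiftPairSystem, hzero, neg_zero,
    Finset.insert_eq_of_mem (Finset.mem_singleton_self _), Finset.card_singleton, pow_one,
    Nat.cast_sub hp.one_le]
  have hp2 : (2 : ℝ) ≤ p := by exact_mod_cast hp.two_le
  have hp1 : (p : ℝ) - 1 ≠ 0 := by linarith
  have hp0 : (p : ℝ) ≠ 0 := by linarith
  field_simp
  push_cast
  ring

/-- For a prime `p ∤ h`: `β_p = p⁻¹ (p/(p-1))² (p - 2) = 1 - 1/(p-1)²` (`= 0` at `p = 2`: the local
obstruction of an odd shift). [cite: GreenTao2010, Example 1] -/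
private theorem localFactor_shiftPairSystem_of_not_dvd {h p : ℕ} (hp : p.Prime) (hndvd : ¬ p ∣ h) :
    localFactor (shiftPairSystem (h : ℤ)) p = 1 - 1 / ((p : ℝ) - 1) ^ 2 := by
  haveI := Fact.mk hp
  have hne : ((h : ℤ) : ZMod p) ≠ 0 := by
    rw [Int.cast_natCast, Ne, ZMod.natCast_eq_zero_iff]; exact hndvd
  have hne' : (0 : ZMod p) ≠ -((h : ℤ) : ZMod p) := fun h' => hne (neg_eq_zero.mp h'.symm)
  rw [localFactor_prime, goodCount_shiftPairSystem, Finset.card_pair hne', pow_one,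
    Nat.cast_sub hp.two_le]
  have hp2 : (2 : ℝ) ≤ p := by exact_mod_cast hp.two_le
  have hp1 : (p : ℝ) - 1 ≠ 0 := by linarith
  have hp0 : (p : ℝ) ≠ 0 := by linarith
  field_simp
  push_cast
  ring


/-- `p/(p-1) = (1 - 1/(p-1)²) · (p-1)/(p-2)` for `p > 2`. [folklore] -/
private theorem div_pred_eq_mul {p : ℕ} (hp : 2 < p) :
    (p : ℝ) / ((p : ℝ) - 1) = (1 - 1 / ((p : ℝ) - 1) ^ 2) * (((p : ℝ) - 1) / ((p : ℝ) - 2)) := by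
  have hp3 : (3 : ℝ) ≤ p := by exact_mod_cast hp
  have hp1 : (p : ℝ) - 1 ≠ 0 := by linarith
  have hp2 : (p : ℝ) - 2 ≠ 0 := by linarith
  field_simp
  ring

/-- For even `h` and `x ≥ 2`: `∏_{p ≤ x} β_p = 2 · ∏_{2 < p ≤ x} (1 - 1/(p-1)²) · ∏_{2 < p ≤ x, p ∣ h} (p-1)/(p-2)`.
[cite: GreenTao2010, Example 1] -/
private theorem singularProductPartial_shiftPairSystem {h x : ℕ} (hh : Even h) (hx : 2 ≤ x) :
    singularProductPartial (shiftPairSystem (h : ℤ)) x =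
      2 * twinPrimeConstPartial x *
        ∏ p ∈ (Nat.primesLE x).filter (fun p => 2 < p ∧ p ∣ h), (((p : ℝ) - 1) / ((p : ℝ) - 2)) := by
  rw [singularProductPartial, twinPrimeConstPartial]
  have h2 : 2 ∈ Nat.primesLE x := Nat.mem_primesLE.mpr ⟨hx, Nat.prime_two⟩
  rw [← Finset.mul_prod_erase _ _ h2,
    localFactor_shiftPairSystem_of_dvd Nat.prime_two (even_iff_two_dvd.mp hh)]
  have herase : (Nat.primesLE x).erase 2 = (Nat.primesLE x).filter (2 < ·) := by
    ext p
    simp only [Finset.mem_erase, Finset.mem_filter, Nat.mem_primesLE]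
    constructor
    · rintro ⟨hne, hpx, hp⟩
      exact ⟨⟨hpx, hp⟩, lt_of_le_of_ne hp.two_le (Ne.symm hne)⟩
    · rintro ⟨⟨hpx, hp⟩, h2p⟩
      exact ⟨h2p.ne', hpx, hp⟩
  have hβ2 : ((2 : ℕ) : ℝ) / (((2 : ℕ) : ℝ) - 1) = 2 := by norm_num
  have hpt : ∀ p ∈ (Nat.primesLE x).filter (2 < ·), localFactor (shiftPairSystem (h : ℤ)) p =
      (1 - 1 / ((p : ℝ) - 1) ^ 2) * (if p ∣ h then ((p : ℝ) - 1) / ((p : ℝ) - 2) else 1) := by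
    intro p hp
    obtain ⟨hp', h2p⟩ := Finset.mem_filter.mp hp
    have hpp : p.Prime := (Nat.mem_primesLE.mp hp').2
    by_cases hdvd : p ∣ h
    · rw [if_pos hdvd, localFactor_shiftPairSystem_of_dvd hpp hdvd, div_pred_eq_mul h2p]
    · rw [if_neg hdvd, localFactor_shiftPairSystem_of_not_dvd hpp hdvd, mul_one]
  rw [herase, hβ2, Finset.prod_congr rfl hpt, Finset.prod_mul_distrib, ← Finset.prod_filter,
    Finset.filter_filter, mul_assoc]

/-- For `x ≥ h ≥ 1` the primes `2 < p ≤ x` dividing `h` are the odd prime factors of `h`. [folklore] -/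
private theorem primesLE_filter_dvd_eq {h x : ℕ} (h0 : h ≠ 0) (hx : h ≤ x) :
    (Nat.primesLE x).filter (fun p => 2 < p ∧ p ∣ h) = h.primeFactors.filter (2 < ·) := by
  ext p
  simp only [Finset.mem_filter, Nat.mem_primesLE, Nat.mem_primeFactors]
  constructor
  · rintro ⟨⟨-, hp⟩, h2p, hdvd⟩
    exact ⟨⟨hp, hdvd, h0⟩, h2p⟩
  · rintro ⟨⟨hp, hdvd, -⟩, h2p⟩
    exact ⟨⟨(Nat.le_of_dvd (Nat.pos_of_ne_zero h0) hdvd).trans hx, hp⟩, h2p, hdvd⟩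

/-- **`∏_p β_p = 𝔖(h)`**: for an even shift `h ≠ 0` the Green–Tao singular product of `(n, n + h)`
is the Hardy–Littlewood/Goldbach singular series `2C₂ ∏_{p ∣ h, p > 2} (p-1)/(p-2)`
(`goldbachSingularSeries h`): both ordered partial products converge
(`tendsto_singularProductPartial_holds`, `tendsto_twinPrimeConstPartial_div_two`) and they are
proportional from `x = max 2 h` on. [cite: GreenTao2010, Example 1 and (1.7)] -/
private theorem singularProduct_shiftPairSystem {h : ℕ} (hh : Even h) (h0 : h ≠ 0) :
    singularProduct (shiftPairSystem (h : ℤ)) = goldbachSingularSeries h := by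
  have hnd : IsNondegenerateSystem (shiftPairSystem (h : ℤ)) :=
    isNondegenerateSystem_shiftPairSystem_iff.mpr (by exact_mod_cast h0)
  have h1 : Tendsto (singularProductPartial (shiftPairSystem (h : ℤ))) atTop
      (𝓝 (singularProduct (shiftPairSystem (h : ℤ)))) :=
    tendsto_singularProductPartial_holds 1 2 _ hnd
  have hC : Tendsto twinPrimeConstPartial atTop (𝓝 twinPrimeConst) := by
    rw [twinPrimeConst_eq_singularSeries_pair_div_two]
    exact tendsto_twinPrimeConstPartial_div_two
  set F : ℝ := ∏ p ∈ h.primeFactors.filter (2 < ·), (((p : ℝ) - 1) / ((p : ℝ) - 2)) with hF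
  have h2 : Tendsto (singularProductPartial (shiftPairSystem (h : ℤ))) atTop
      (𝓝 (2 * twinPrimeConst * F)) := by
    have hlim : Tendsto (fun x => 2 * twinPrimeConstPartial x * F) atTop
        (𝓝 (2 * twinPrimeConst * F)) :=
      (hC.const_mul 2).mul_const F
    refine hlim.congr' ?_
    rw [EventuallyEq, eventually_atTop]
    refine ⟨max 2 h, fun x hx => ?_⟩
    rw [singularProductPartial_shiftPairSystem hh (le_of_max_le_left hx),
      primesLE_filter_dvd_eq h0 (le_of_max_le_right hx)]
  rw [goldbachSingularSeries_of_even h hh]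
  exact tendsto_nhds_unique h1 h2

end Dictionary

open Dictionary

/-! ## Necessity: the summit conjunct implies every cell of the dial -/



/-- `GHL → UpperBlock`. [folklore] -/
theorem upperBlock_of_ghl (h : _root_.GeneralizedHardyLittlewood) : UpperBlock := by
  intro d t L hd ht ε hε
  obtain ⟨N₀, hN₀⟩ := h d t L hd ht ε hε
  exact ⟨N₀, fun N hN Ψ hΨ hL K hK hKN => (abs_le.mp (hN₀ N hN Ψ hΨ hL K hK hKN)).2⟩

/-- `GHL → LowerBlock`. [folklore] -/
theorem lowerBlock_of_ghl (h : _root_.GeneralizedHardyLittlewood) : LowerBlock := by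
  intro d t L hd ht ε hε
  obtain ⟨N₀, hN₀⟩ := h d t L hd ht ε hε
  refine ⟨N₀, fun N hN Ψ hΨ hL K hK hKN => ?_⟩
  have := (abs_le.mp (hN₀ N hN Ψ hΨ hL K hK hKN)).1
  linarith

/-- **Every cell of the shift dial is NECESSARY**: the uniform upper half contains the systems
`(n, n + h)`, `h ≤ N`, at size `‖Ψ‖_N ≤ 3` on `K = [-N, N]` (dictionary), for every range `R`.
[cite: GreenTao2010, Conjecture 1.2] -/
theorem uniformUpperUpTo_of_upperBlock (hU : UpperBlock) (R : ℕ → ℝ) : UniformUpperUpTo R := by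
  intro ε hε
  obtain ⟨N₀, hN₀⟩ := hU 1 2 3 le_rfl (by norm_num) ε hε
  refine ⟨max N₀ 1, fun N hN h hh0 hhe hhN _hhR => ?_⟩
  have hNpos : 0 < N := lt_of_lt_of_le one_pos (le_of_max_le_right hN)
  have hnd : IsNondegenerateSystem (shiftPairSystem (h : ℤ)) :=
    isNondegenerateSystem_shiftPairSystem_iff.mpr (by exact_mod_cast hh0)
  have hGq := hN₀ N (le_of_max_le_left hN) (shiftPairSystem (h : ℤ)) hnd
    (affLinSize_shiftPairSystem_le hNpos hhN) (realBox 1 N) (convex_Icc _ _) subset_rfl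
  rw [vonMangoldtSum_shiftPairSystem, archFactor_shiftPairSystem,
    singularProduct_shiftPairSystem hhe hh0, pow_one] at hGq
  exact hGq

/-- Lower side of `uniformUpperUpTo_of_upperBlock`. [cite: GreenTao2010, Conjecture 1.2] -/
theorem uniformLowerUpTo_of_lowerBlock (hL : LowerBlock) (R : ℕ → ℝ) : UniformLowerUpTo R := by
  intro ε hε
  obtain ⟨N₀, hN₀⟩ := hL 1 2 3 le_rfl (by norm_num) ε hε
  refine ⟨max N₀ 1, fun N hN h hh0 hhe hhN _hhR => ?_⟩
  have hNpos : 0 < N := lt_of_lt_of_le one_pos (le_of_max_le_right hN)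
  have hnd : IsNondegenerateSystem (shiftPairSystem (h : ℤ)) :=
    isNondegenerateSystem_shiftPairSystem_iff.mpr (by exact_mod_cast hh0)
  have hGq := hN₀ N (le_of_max_le_left hN) (shiftPairSystem (h : ℤ)) hnd
    (affLinSize_shiftPairSystem_le hNpos hhN) (realBox 1 N) (convex_Icc _ _) subset_rfl
  rw [vonMangoldtSum_shiftPairSystem, archFactor_shiftPairSystem,
    singularProduct_shiftPairSystem hhe hh0, pow_one] at hGq
  exact hGq

/-- `GHL → UniformUpperUpTo R` for every range. [cite: GreenTao2010, Conjecture 1.2] -/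
theorem uniformUpperUpTo_of_ghl (h : _root_.GeneralizedHardyLittlewood) (R : ℕ → ℝ) :
    UniformUpperUpTo R :=
  uniformUpperUpTo_of_upperBlock (upperBlock_of_ghl h) R

/-- `GHL → UniformLowerUpTo R` for every range. [cite: GreenTao2010, Conjecture 1.2] -/
theorem uniformLowerUpTo_of_ghl (h : _root_.GeneralizedHardyLittlewood) (R : ℕ → ℝ) :
    UniformLowerUpTo R :=
  uniformLowerUpTo_of_lowerBlock (lowerBlock_of_ghl h) R

end Summit.Parity.GeneralizedHardyLittlewood.RangeQualityExchange
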